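import Mathlib
import Summits.Ventures.HodgeRepro2.T5AmiceTransform

/-!
# T5AmiceIsometry — the Amice transform is an isometry: `‖m‖ = sup_n ‖m(x choose n)‖`

Cell pub-hodge-repro2, Tier 5 support (seat p7; route/T5-CHECK-G-p7.md §3 S4 / S5). §G's step S5 reads
the measure `m := L⁻_{Σ,λ⁻¹,𝔭}` as the power series `f_m ∈ W[[T]]` and applies Weierstrass preparation
`f_m = p^μ · P · U` to it; S4 computes the μ-invariant of `m` as «inf over opens». The two μ's are the
same number because the Amice transform `m ↦ f_m = Σ_n m(x choose n) Tⁿ` (T5AmiceTransform, p400619)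
is an ISOMETRY from bounded functionals on `C(ℤ_p, R)` to power series with the sup-of-coefficients
norm. This file proves that isometry for the cell's measure model (`R` a complete ultrametric normed
`ℤ_p`-algebra, `m : C(ℤ_[p], R) →ₗ[R] R` continuous):

* `norm_map_le_of_forall_norm_coeff_le`: if `‖m(x choose n)‖ ≤ C` for every `n` then `‖m f‖ ≤ C‖f‖`
  for every `f` (Mahler's theorem `m f = Σ_n (Δⁿf)(0)·m(x choose n)`, the bound `‖(Δⁿf)(0)‖ ≤ ‖f‖`
  of Mathlib's `IsUltrametricDist.norm_fwdDiff_iter_apply_le`, and the ultrametric bound on a series);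
* `bound_iff_forall_norm_coeff_le`: for `‖1‖ = 1`, «`‖m f‖ ≤ C‖f‖` for all `f`» ⟺
  «`‖coeff_n f_m‖ ≤ C` for all `n`»;
* `coeffSup m := ⨆ n, ‖coeff_n f_m‖` and `isLeast_coeffSup`: `coeffSup m` is the LEAST constant
  `C ≥ 0` with `‖m f‖ ≤ C‖f‖` — i.e. the operator norm of `m` equals the sup norm of `f_m`
  (Mathlib's `opNorm` is only defined over a normed field, so the statement is given as `IsLeast`).

Consequence for §G (drawn in T5MuInvariantAmice): the μ-invariant of `m` as an infimum of valuations
over opens (T5MuInvariantPadic `mu`) equals `inf_n v_p(coeff_n f_m)`, the μ-invariant of the power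
series `f_m` used by Weierstrass preparation. Mathlib + own T5AmiceTransform only.
-/

namespace Summit.Ventures.HodgeRepro2.T5AmiceIsometry

open PadicInt Filter Topology
open Summit.Ventures.HodgeRepro2.T5AmiceTransform
open scoped fwdDiff

variable {p : ℕ} [hp : Fact p.Prime]
variable {R : Type*} [NormedCommRing R] [Algebra ℤ_[p] R] [IsBoundedSMul ℤ_[p] R]
  [IsUltrametricDist R] [CompleteSpace R]

/-- UPPER BOUND: if every moment `m(x choose n)` has norm `≤ C`, then `‖m f‖ ≤ C ‖f‖` for every
`f ∈ C(ℤ_p, R)`. Proof: `m f = Σ_n (Δⁿf)(0)·m(x choose n)` (Mahler), `‖(Δⁿf)(0)‖ ≤ ‖f‖`, and a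
convergent series in an ultrametric group is bounded by the sup of its terms. -/
theorem norm_map_le_of_forall_norm_coeff_le (m : C(ℤ_[p], R) →ₗ[R] R) (hm : Continuous m)
    {C : ℝ} (hC : 0 ≤ C) (h : ∀ n, ‖PowerSeries.coeff n (amice m)‖ ≤ C) (f : C(ℤ_[p], R)) :
    ‖m f‖ ≤ C * ‖f‖ := by
  rw [map_eq_tsum_fwdDiff m hm f]
  refine IsUltrametricDist.norm_tsum_le_of_forall_le_of_nonneg (by positivity) fun n => ?_
  calc ‖((fwdDiff (1 : ℤ_[p]))^[n] (⇑f) 0) * m (mahlerTerm (1 : R) n)‖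
      ≤ ‖(fwdDiff (1 : ℤ_[p]))^[n] (⇑f) 0‖ * ‖m (mahlerTerm (1 : R) n)‖ := norm_mul_le _ _
    _ ≤ ‖f‖ * C := by
        gcongr
        · exact IsUltrametricDist.norm_fwdDiff_iter_apply_le 1 f 0 n
        · simpa only [coeff_amice] using h n
    _ = C * ‖f‖ := mul_comm _ _

omit [IsUltrametricDist R] [CompleteSpace R] in
/-- LOWER BOUND (restated from T5AmiceTransform with `‖1‖ = 1`): a bound `‖m f‖ ≤ C‖f‖` bounds every
moment: `‖coeff_n f_m‖ ≤ C`. -/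
theorem norm_coeff_le_of_bound [NormOneClass R] (m : C(ℤ_[p], R) →ₗ[R] R) {C : ℝ}
    (hb : ∀ f, ‖m f‖ ≤ C * ‖f‖) (n : ℕ) : ‖PowerSeries.coeff n (amice m)‖ ≤ C := by
  have := norm_coeff_amice_le m C hb n
  rwa [norm_one, mul_one] at this

/-- THE ISOMETRY, bound form: for `‖1‖ = 1` and `m` continuous, «`‖m f‖ ≤ C‖f‖` for every `f`» ⟺
«`‖coeff_n f_m‖ ≤ C` for every `n`». -/
theorem bound_iff_forall_norm_coeff_le [NormOneClass R] (m : C(ℤ_[p], R) →ₗ[R] R)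
    (hm : Continuous m) {C : ℝ} :
    (∀ f, ‖m f‖ ≤ C * ‖f‖) ↔ ∀ n, ‖PowerSeries.coeff n (amice m)‖ ≤ C := by
  constructor
  · exact norm_coeff_le_of_bound m
  · intro h
    have hC : 0 ≤ C := (norm_nonneg _).trans (h 0)
    exact norm_map_le_of_forall_norm_coeff_le m hm hC h

/-- The sup norm of the power series `f_m`: `coeffSup m := ⨆ n, ‖coeff_n f_m‖`. -/
noncomputable def coeffSup (m : C(ℤ_[p], R) →ₗ[R] R) : ℝ :=
  ⨆ n, ‖PowerSeries.coeff n (amice m)‖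

omit [IsUltrametricDist R] [CompleteSpace R] in
/-- For a bounded `m` the moment norms are bounded above (by `C‖1‖`). -/
theorem bddAbove_range_norm_coeff (m : C(ℤ_[p], R) →ₗ[R] R) {C : ℝ}
    (hb : ∀ f, ‖m f‖ ≤ C * ‖f‖) :
    BddAbove (Set.range fun n => ‖PowerSeries.coeff n (amice m)‖) := by
  refine ⟨C * ‖(1 : R)‖, ?_⟩
  rintro _ ⟨n, rfl⟩
  exact norm_coeff_amice_le m C hb n

omit [IsUltrametricDist R] [CompleteSpace R] in
/-- `‖coeff_n f_m‖ ≤ coeffSup m` for a bounded `m`. -/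
theorem norm_coeff_le_coeffSup (m : C(ℤ_[p], R) →ₗ[R] R) {C : ℝ}
    (hb : ∀ f, ‖m f‖ ≤ C * ‖f‖) (n : ℕ) :
    ‖PowerSeries.coeff n (amice m)‖ ≤ coeffSup m :=
  le_ciSup (bddAbove_range_norm_coeff m hb) n

omit [IsUltrametricDist R] [CompleteSpace R] in
/-- `0 ≤ coeffSup m`. -/
theorem coeffSup_nonneg (m : C(ℤ_[p], R) →ₗ[R] R) : 0 ≤ coeffSup m :=
  Real.iSup_nonneg fun _ => norm_nonneg _

omit [IsUltrametricDist R] [CompleteSpace R] in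
/-- `coeffSup m ≤ C` as soon as every moment has norm `≤ C`. -/
theorem coeffSup_le (m : C(ℤ_[p], R) →ₗ[R] R) {C : ℝ}
    (h : ∀ n, ‖PowerSeries.coeff n (amice m)‖ ≤ C) : coeffSup m ≤ C :=
  ciSup_le h

/-- `‖m f‖ ≤ coeffSup m · ‖f‖` for every `f` (a continuous, bounded `m`). -/
theorem norm_map_le_coeffSup_mul (m : C(ℤ_[p], R) →ₗ[R] R) (hm : Continuous m) {C : ℝ}
    (hb : ∀ f, ‖m f‖ ≤ C * ‖f‖) (f : C(ℤ_[p], R)) : ‖m f‖ ≤ coeffSup m * ‖f‖ :=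
  norm_map_le_of_forall_norm_coeff_le m hm (coeffSup_nonneg m) (norm_coeff_le_coeffSup m hb) f

/-- THE ISOMETRY: for `‖1‖ = 1`, `coeffSup m = sup_n ‖m(x choose n)‖` is the LEAST constant `C ≥ 0`
with `‖m f‖ ≤ C‖f‖` for every `f` — «the operator norm of the measure `m` is the sup norm of its
power series `f_m`». -/
theorem isLeast_coeffSup [NormOneClass R] (m : C(ℤ_[p], R) →ₗ[R] R) (hm : Continuous m) {C : ℝ}
    (hb : ∀ f, ‖m f‖ ≤ C * ‖f‖) :
    IsLeast {D : ℝ | 0 ≤ D ∧ ∀ f, ‖m f‖ ≤ D * ‖f‖} (coeffSup m) := by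
  refine ⟨⟨coeffSup_nonneg m, norm_map_le_coeffSup_mul m hm hb⟩, ?_⟩
  rintro D ⟨-, hD⟩
  exact coeffSup_le m (norm_coeff_le_of_bound m hD)

/-- The least bound is attained on the Mahler basis: `coeffSup m = sInf {D | 0 ≤ D ∧ ∀ f, ‖m f‖ ≤ D‖f‖}`
(the operator-norm formula). -/
theorem coeffSup_eq_sInf [NormOneClass R] (m : C(ℤ_[p], R) →ₗ[R] R) (hm : Continuous m) {C : ℝ}
    (hb : ∀ f, ‖m f‖ ≤ C * ‖f‖) :
    coeffSup m = sInf {D : ℝ | 0 ≤ D ∧ ∀ f, ‖m f‖ ≤ D * ‖f‖} :=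
  ((isLeast_coeffSup m hm hb).csInf_eq).symm

omit [IsUltrametricDist R] [CompleteSpace R] in
/-- The sup norm of `f_m` is attained up to `ε`: for every `ε > 0` some moment has norm
`> coeffSup m − ε`. -/
theorem exists_norm_coeff_gt (m : C(ℤ_[p], R) →ₗ[R] R) {ε : ℝ} (hε : 0 < ε) :
    ∃ n, coeffSup m - ε < ‖PowerSeries.coeff n (amice m)‖ := by
  have hne : (Set.range fun n => ‖PowerSeries.coeff n (amice m)‖).Nonempty := ⟨_, 0, rfl⟩
  have hlt : coeffSup m - ε < sSup (Set.range fun n => ‖PowerSeries.coeff n (amice m)‖) :=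
    sub_lt_self (coeffSup m) hε
  obtain ⟨_, ⟨n, rfl⟩, hn⟩ := exists_lt_of_lt_csSup hne hlt
  exact ⟨n, hn⟩

/-- `coeffSup m = 0 ⟺ m = 0` (a continuous, bounded `m`): the isometry is injective. -/
theorem coeffSup_eq_zero_iff (m : C(ℤ_[p], R) →ₗ[R] R) (hm : Continuous m) {C : ℝ}
    (hb : ∀ f, ‖m f‖ ≤ C * ‖f‖) : coeffSup m = 0 ↔ m = 0 := by
  constructor
  · intro h
    rw [← amice_eq_zero_iff m hm]
    ext n
    have h1 := norm_coeff_le_coeffSup m hb n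
    rw [h] at h1
    simpa using le_antisymm h1 (norm_nonneg _)
  · rintro rfl
    refine le_antisymm (coeffSup_le 0 fun n => ?_) (coeffSup_nonneg 0)
    simp [coeff_amice]

end Summit.Ventures.HodgeRepro2.T5AmiceIsometry
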